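import Literature.AlgebraicGeometry.HodgeTheory.KunnethComponentsOfAlgebraicClasses
import Literature.AlgebraicGeometry.HodgeTheory.KunnethStandardConjecturePowers
import HarnessLib

/-!
# The Künneth components of an algebraic class, with no restriction on the dimensions: cycles of
# dimension `≤ 2` on ANY product `W × X`, and cycles dominated along surjections

Family `hodge`, layer `Literature/AlgebraicGeometry/HodgeTheory`; namespace
`Literature.AlgebraicGeometry.HodgeTheory`; lane `lit-hodgefound`. THEOREMS ONLY (no definition, no
named fact; D-0026).

The tree's `KunnethComponentsOfPushPullClasses` (§3) and `KunnethComponentsOfAlgebraicClasses` carry the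
hypothesis `dim W ≤ dim S` (resp. `dim W ≤ d`, `d` the cycle dimension): it only served to keep the index
`d = i + 2 dim S − 2 dim X` of the Künneth component `π_S d` of `cl(Δ_S)` inside `[0, 2 dim S]`. It is
superfluous: a Künneth component of `X`-degree `i > 2 dim X` lies in `H^{2e−i}(W) ⊗ Hⁱ(X) = 0`
(the tree's `kunnethComponent_pushPullClass_eq_zero_of_gt`), and for `i ≤ 2 dim X` the index is in range.
Hence, with the SAME proofs (Kleiman / Kahn Def. 6.29, Lemma 6.30: the Künneth components
`γ_{(2e−i,i)}` of an algebraic `γ` are `(f ⊗ g)_*` of the algebraic Künneth components of `cl(Δ_S)` for the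
dominating `S`, and depend linearly on `γ`):

* §1 `kunnethComponent_pushPullClass_mem_algebraicClasses'`, `…_of_forall'` — under `C(S)` every Künneth
  component of `[(f, g)_* 1_S] ∈ H^{2e}((W ⊗ X)(ℂ); ℂ)` is algebraic, for ALL `f : S ⟶ W`, `g : S ⟶ X`
  (`dim S + e = dim W + dim X`), any dimensions.
* §2 **`kunnethComponent_mem_algebraicClasses_of_forall_source'`** — if `C(V)` holds for every smooth
  projective `V` of dimension `d`, then every Künneth component of every algebraic class
  `γ ∈ Nᵉ H^{2e}((W ⊗ X)(ℂ); ℂ)`, `d + e = dim W + dim X`, is algebraic (ANY `W`, `X`);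
  `…_of_forall_surjective_source'` — the same when every such `V` is DOMINATED by a variety satisfying `C`
  (`C` descends along surjections, the tree's `kunnethComponents_algebraic_of_surjective`).
* §3 **UNCONDITIONALLY: `kunnethComponent_mem_algebraicClasses_of_le_two'` — every algebraic class of
  CYCLE DIMENSION `≤ 2` on ANY product `W ⊗ X` of smooth projective complex varieties has algebraic
  Künneth components** (`C` in dimension `≤ 2`); named: `kunnethComponent_mem_algebraicClasses_pointClasses`
  (`e = dim W + dim X`), `…_curveClasses` (`1 + e = dim W + dim X`), `…_surfaceClasses`
  (`2 + e = dim W + dim X`).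
* §4 Explicit families, any dimensions: `kunnethComponent_mem_algebraicClasses_of_eq_sum_complexGysin_one'`
  (`γ = Σ aⱼ (hⱼ)_* 1_{Vⱼ}`, `C(Vⱼ)`), `…_abelianVariety'`, `…_tensor_of_le_two'`, and
  **`…_of_eq_sum_complexGysin_one_of_surjective`** (`Vⱼ` dominated by `Yⱼ ↠ Vⱼ` with `C(Yⱼ)`, any relative
  dimension), `…_of_surjective_abelianVariety` (cycles dominated by abelian varieties of any dimension),
  `…_of_surjective_tensor_of_le_two` (cycles dominated by products `P × Q`, `dim P, dim Q ≤ 2`, of any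
  dimension `≥` the cycle dimension).

## References

* [Kahn2020] B. Kahn, Zeta and L-functions of varieties and motives, LMS LN 462, CUP 2020, §6.9
  Def. 6.29, Lemma 6.30, Thm. 6.31.
* [Kleiman1968AlgebraicCycles] S. Kleiman, Algebraic cycles and the Weil conjectures (1968), §2.
* [Fulton1998] W. Fulton, Intersection Theory, 2nd ed., Springer 1998, §16.1 Prop. 16.1.1 (c),
  §19.1 Lemma 19.1.1.
* [VoisinHodgeI2002] C. Voisin, Hodge Theory and Complex Algebraic Geometry I, CUP 2002, §11.3.3 p. 286.
* [Voisin2002] idem, §7.3.2 Lemma 7.28.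
* [Voisin2025] C. Voisin, Hodge and generalized Hodge conjectures, coniveau and algebraic cycles,
  J. Open Math. Probl. 1 (2025), §3.2.1 Cor. 3.9, (12)–(14).
-/

noncomputable section

open CategoryTheory AlgebraicGeometry MonoidalCategory CartesianMonoidalCategory Finset
open Literature.AlgebraicTopology.SingularHomology
open Literature.AlgebraicGeometry.Motives (IsSmoothProjective ComplexPoints)

namespace Literature.AlgebraicGeometry.HodgeTheory

variable {l m n d e k : ℕ} {S W X Y : Motives.SchemeOver ℂ}

/-! ### §1 Push–pull classes `[(f, g)_* 1_S]`, any dimensions -/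

section Components

variable {π : Fin (2 * l + 1) → complexBetti (S ⊗ S) (2 * l)}
  {ρ : Fin (2 * e + 1) → complexBetti (W ⊗ X) (2 * e)}

/-- **Under `C(S)` every Künneth component of the push–pull class `[(f, g)_* 1] ∈ H^{2e}((W ⊗ X)(ℂ); ℂ)`
is algebraic**, for `f : S ⟶ W`, `g : S ⟶ X`, `dim S + e = dim W + dim X` and NO hypothesis on the
dimensions (the tree's `kunnethComponent_pushPullClass_mem_algebraicClasses` assumes `dim W ≤ dim S`):
the component of `X`-degree `i` is zero if `i + 2 dim S < 2 dim X` (`…_eq_zero_of_lt`) or `i > 2 dim X`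
(`…_eq_zero_of_gt`, the piece `H^{2e−i}(W) ⊗ Hⁱ(X)` vanishes), and otherwise it is `(f ⊗ g)_* π_S d`,
`d = i + 2 dim S − 2 dim X ∈ [0, 2 dim S]`, a Gysin image of the algebraic `π_S d`
(`kunnethComponent_pushPullClass_eq`). [cite: Kahn2020, §6.9 Def. 6.29 and Lemma 6.30]
[cite: Fulton1998, §16.1 Prop. 16.1.1 (c)] [cite: VoisinHodgeI2002, §11.3.3 p. 286] -/
theorem kunnethComponent_pushPullClass_mem_algebraicClasses' (hS : IsSmoothProjective l S)
    (hW : IsSmoothProjective m W) (hX : IsSmoothProjective n X) (f : S ⟶ W) (g : S ⟶ X)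
    (hle : l + e = m + n)
    (hπ : ∀ i : Fin (2 * l + 1), π i ∈ kunnethPiece S S (show (2 * l - (i : ℕ)) + i = 2 * l by omega))
    (hΔ : ∑ i, π i = diagonalClass hS) (hC : ∀ i, π i ∈ algebraicClasses (S ⊗ S) l)
    (hρ : ∀ i : Fin (2 * e + 1), ρ i ∈ kunnethPiece W X (show (2 * e - (i : ℕ)) + i = 2 * e by omega))
    (hΓ : ∑ i, ρ i =
      complexGysin complexOrientationFamily hS (Motives.IsSmoothProjective.tensor_holds hW hX)
        (lift f g) (show 0 + 2 * (m + n) = 2 * e + 2 * l by omega)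
        (singularCohomology.one ℂ (ComplexPoints S)))
    (i : Fin (2 * e + 1)) :
    ρ i ∈ algebraicClasses (W ⊗ X) e := by
  by_cases hlt : (i : ℕ) + 2 * l < 2 * n
  · rw [kunnethComponent_pushPullClass_eq_zero_of_lt hS hW hX f g hle hρ hΓ i hlt]
    exact Submodule.zero_mem _
  by_cases hgt : 2 * n < (i : ℕ)
  · rw [kunnethComponent_pushPullClass_eq_zero_of_gt hX hρ i hgt]
    exact Submodule.zero_mem _
  -- the component is `(f ⊗ g)_* π_S d`, `d = i + 2l − 2n ≤ 2l` (as `i ≤ 2n`)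
  have hd : (i : ℕ) + 2 * l - 2 * n < 2 * l + 1 := by omega
  rw [kunnethComponent_pushPullClass_eq hS hW hX f g hle hπ hΔ hρ hΓ i ⟨(i : ℕ) + 2 * l - 2 * n, hd⟩
    (by simp only; omega)]
  exact complexGysin_mem_algebraicClasses_of_mem_algebraicClasses complexOrientationFamily
    (Motives.IsSmoothProjective.tensor_holds hS hS) (Motives.IsSmoothProjective.tensor_holds hW hX)
    (f ⊗ₘ g) _ (hC _)

end Components

/-- **Under `C(S)` every Künneth component of `[(f, g)_* 1]` is algebraic**, family-free form, any
dimensions (`f : S ⟶ W`, `g : S ⟶ X`, `dim S + e = dim W + dim X`).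
[cite: Kahn2020, §6.9 Def. 6.29 and Lemma 6.30] [cite: Fulton1998, §16.1 Prop. 16.1.1 (c)] -/
theorem kunnethComponent_pushPullClass_mem_algebraicClasses_of_forall' (hS : IsSmoothProjective l S)
    (hW : IsSmoothProjective m W) (hX : IsSmoothProjective n X) (f : S ⟶ W) (g : S ⟶ X)
    (hle : l + e = m + n)
    (hCS : ∀ (πS : Fin (2 * l + 1) → complexBetti (S ⊗ S) (2 * l)),
      (∀ i : Fin (2 * l + 1), πS i ∈ kunnethPiece S S (show (2 * l - (i : ℕ)) + i = 2 * l by omega)) →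
      ∑ i, πS i = diagonalClass hS → ∀ i, πS i ∈ algebraicClasses (S ⊗ S) l)
    {ρ : Fin (2 * e + 1) → complexBetti (W ⊗ X) (2 * e)}
    (hρ : ∀ i : Fin (2 * e + 1), ρ i ∈ kunnethPiece W X (show (2 * e - (i : ℕ)) + i = 2 * e by omega))
    (hΓ : ∑ i, ρ i =
      complexGysin complexOrientationFamily hS (Motives.IsSmoothProjective.tensor_holds hW hX)
        (lift f g) (show 0 + 2 * (m + n) = 2 * e + 2 * l by omega)
        (singularCohomology.one ℂ (ComplexPoints S)))
    (i : Fin (2 * e + 1)) :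
    ρ i ∈ algebraicClasses (W ⊗ X) e := by
  obtain ⟨⟨πS, hπS, hΔS⟩⟩ := nonempty_kunnethComponents_diagonalClass hS
  exact kunnethComponent_pushPullClass_mem_algebraicClasses' hS hW hX f g hle hπS hΔS
    (hCS πS hπS hΔS) hρ hΓ i

/-! ### §2 Algebraic classes whose cycle dimension carries `C`, any `W`, `X` -/

/-- **If `C(V)` holds for every smooth projective `V` of dimension `d`, then every Künneth component of
every algebraic class `γ ∈ Nᵉ H^{2e}((W ⊗ X)(ℂ); ℂ)`, `d + e = dim W + dim X`, is algebraic** — for ALL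
smooth projective `W`, `X` (the tree's `kunnethComponent_mem_algebraicClasses_of_forall_source` assumes
`dim W ≤ d`): `γ` is a linear combination of push–pull classes `(h ≫ pr_W, h ≫ pr_X)_* 1_V`
(`algebraicClasses_eq_span_complexGysin_one`), §1, and linearity
(`kunnethComponent_mem_algebraicClasses_of_mem_span`). [cite: Kahn2020, §6.9 Def. 6.29 and Lemma 6.30]
[cite: Kleiman1968AlgebraicCycles, §2] [cite: Fulton1998, §19.1 Lemma 19.1.1 and §16.1 Prop. 16.1.1 (c)] -/
theorem kunnethComponent_mem_algebraicClasses_of_forall_source' (hW : IsSmoothProjective m W)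
    (hX : IsSmoothProjective n X) (hde : d + e = m + n)
    (hC : ∀ (V : Motives.SchemeOver ℂ) (hV : IsSmoothProjective d V)
      (πV : Fin (2 * d + 1) → complexBetti (V ⊗ V) (2 * d)),
      (∀ i : Fin (2 * d + 1), πV i ∈ kunnethPiece V V (show (2 * d - (i : ℕ)) + i = 2 * d by omega)) →
      ∑ i, πV i = diagonalClass hV → ∀ i, πV i ∈ algebraicClasses (V ⊗ V) d)
    {γ : complexBetti (W ⊗ X) (2 * e)} (hγ : γ ∈ algebraicClasses (W ⊗ X) e)
    {ρ : Fin (2 * e + 1) → complexBetti (W ⊗ X) (2 * e)}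
    (hρ : ∀ i : Fin (2 * e + 1), ρ i ∈ kunnethPiece W X (show (2 * e - (i : ℕ)) + i = 2 * e by omega))
    (hΓ : ∑ i, ρ i = γ) (i : Fin (2 * e + 1)) :
    ρ i ∈ algebraicClasses (W ⊗ X) e := by
  have hWX := Motives.IsSmoothProjective.tensor_holds hW hX
  rw [algebraicClasses_eq_span_complexGysin_one complexOrientationFamily e d hde hWX] at hγ
  refine kunnethComponent_mem_algebraicClasses_of_mem_span hW hX ?_ hγ hρ hΓ i
  rintro _ ⟨V, hV, h, rfl⟩ ρ' hρ' hΓ'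
  have hh : h = lift (h ≫ fst W X) (h ≫ snd W X) := by ext <;> simp
  rw [hh] at hΓ'
  exact kunnethComponent_pushPullClass_mem_algebraicClasses_of_forall' hV hW hX (h ≫ fst W X)
    (h ≫ snd W X) hde (hC V hV) hρ' hΓ'

/-- **The same when every smooth projective `d`-fold is DOMINATED by a variety satisfying `C`**: if for
every smooth projective `V` of dimension `d` there are a smooth projective `Y` with `C(Y)` and a surjective
morphism `Y ⟶ V` (any relative dimension), then every Künneth component of every algebraic class
`γ ∈ Nᵉ H^{2e}((W ⊗ X)(ℂ); ℂ)`, `d + e = dim W + dim X`, is algebraic (`C` descends along surjections, the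
tree's `kunnethComponents_algebraic_of_surjective`, Voisin I Lemma 7.28 with the wedge kept).
[cite: Kahn2020, §6.9 Lemma 6.30 (2)] [cite: Voisin2002, §7.3.2 Lemma 7.28] -/
theorem kunnethComponent_mem_algebraicClasses_of_forall_surjective_source' (hW : IsSmoothProjective m W)
    (hX : IsSmoothProjective n X) (hde : d + e = m + n)
    (hC : ∀ (V : Motives.SchemeOver ℂ) (_ : IsSmoothProjective d V),
      ∃ (k : ℕ) (Y : Motives.SchemeOver ℂ) (hY : IsSmoothProjective k Y) (g : Y ⟶ V),
        Surjective g.left ∧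
        ∀ (πY : Fin (2 * k + 1) → complexBetti (Y ⊗ Y) (2 * k)),
          (∀ i : Fin (2 * k + 1), πY i ∈ kunnethPiece Y Y (show (2 * k - (i : ℕ)) + i = 2 * k by omega)) →
          ∑ i, πY i = diagonalClass hY → ∀ i, πY i ∈ algebraicClasses (Y ⊗ Y) k)
    {γ : complexBetti (W ⊗ X) (2 * e)} (hγ : γ ∈ algebraicClasses (W ⊗ X) e)
    {ρ : Fin (2 * e + 1) → complexBetti (W ⊗ X) (2 * e)}
    (hρ : ∀ i : Fin (2 * e + 1), ρ i ∈ kunnethPiece W X (show (2 * e - (i : ℕ)) + i = 2 * e by omega))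
    (hΓ : ∑ i, ρ i = γ) (i : Fin (2 * e + 1)) :
    ρ i ∈ algebraicClasses (W ⊗ X) e := by
  refine kunnethComponent_mem_algebraicClasses_of_forall_source' hW hX hde (fun V hV πV hπV hΔV j ↦ ?_)
    hγ hρ hΓ i
  obtain ⟨k, Y, hY, g, hg, hCY⟩ := hC V hV
  haveI := hg
  exact kunnethComponents_algebraic_of_surjective hY hV g hCY hπV hΔV j

/-! ### §3 Unconditionally: cycles of dimension `≤ 2` on any product -/

/-- **EVERY ALGEBRAIC CLASS OF CYCLE DIMENSION `≤ 2` ON ANY PRODUCT `W ⊗ X` OF SMOOTH PROJECTIVE COMPLEX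
VARIETIES HAS ALGEBRAIC KÜNNETH COMPONENTS** (`d + e = dim W + dim X`, `d ≤ 2`; `C` holds in dimension
`≤ 2`, `kunnethComponent_diagonalClass_mem_algebraicClasses_of_le_two`) — the tree's
`kunnethComponent_mem_algebraicClasses_of_le_two` without its hypothesis `dim W ≤ d`.
[cite: Kahn2020, §6.9 Lemma 6.30 and Theorem 6.31 (1)–(2)] [cite: Voisin2025, §3.2.1 Cor. 3.9] -/
theorem kunnethComponent_mem_algebraicClasses_of_le_two' (hW : IsSmoothProjective m W)
    (hX : IsSmoothProjective n X) (hde : d + e = m + n) (hd : d ≤ 2)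
    {γ : complexBetti (W ⊗ X) (2 * e)} (hγ : γ ∈ algebraicClasses (W ⊗ X) e)
    {ρ : Fin (2 * e + 1) → complexBetti (W ⊗ X) (2 * e)}
    (hρ : ∀ i : Fin (2 * e + 1), ρ i ∈ kunnethPiece W X (show (2 * e - (i : ℕ)) + i = 2 * e by omega))
    (hΓ : ∑ i, ρ i = γ) (i : Fin (2 * e + 1)) :
    ρ i ∈ algebraicClasses (W ⊗ X) e :=
  kunnethComponent_mem_algebraicClasses_of_forall_source' hW hX hde
    (fun _ hV _ hπV hΔV j ↦ kunnethComponent_diagonalClass_mem_algebraicClasses_of_le_two hV hd hπV hΔV j)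
    hγ hρ hΓ i

/-- **Point classes**: every algebraic class of top degree `H^{2(dim W + dim X)}((W ⊗ X)(ℂ); ℂ)`
(`0`-cycles) has algebraic Künneth components. [cite: Kahn2020, §6.9 Lemma 6.30 and Theorem 6.31 (1)] -/
theorem kunnethComponent_mem_algebraicClasses_pointClasses (hW : IsSmoothProjective m W)
    (hX : IsSmoothProjective n X) (he : e = m + n)
    {γ : complexBetti (W ⊗ X) (2 * e)} (hγ : γ ∈ algebraicClasses (W ⊗ X) e)
    {ρ : Fin (2 * e + 1) → complexBetti (W ⊗ X) (2 * e)}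
    (hρ : ∀ i : Fin (2 * e + 1), ρ i ∈ kunnethPiece W X (show (2 * e - (i : ℕ)) + i = 2 * e by omega))
    (hΓ : ∑ i, ρ i = γ) (i : Fin (2 * e + 1)) :
    ρ i ∈ algebraicClasses (W ⊗ X) e :=
  kunnethComponent_mem_algebraicClasses_of_le_two' (d := 0) hW hX (by omega) (by omega) hγ hρ hΓ i

/-- **Curve classes**: every algebraic class of `1`-cycles, `γ ∈ Nᵉ H^{2e}((W ⊗ X)(ℂ); ℂ)` with
`1 + e = dim W + dim X`, on ANY product of smooth projective complex varieties has algebraic Künneth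
components (`C` for curves). [cite: Kahn2020, §6.9 Lemma 6.30 and Theorem 6.31 (1)] -/
theorem kunnethComponent_mem_algebraicClasses_curveClasses (hW : IsSmoothProjective m W)
    (hX : IsSmoothProjective n X) (he : 1 + e = m + n)
    {γ : complexBetti (W ⊗ X) (2 * e)} (hγ : γ ∈ algebraicClasses (W ⊗ X) e)
    {ρ : Fin (2 * e + 1) → complexBetti (W ⊗ X) (2 * e)}
    (hρ : ∀ i : Fin (2 * e + 1), ρ i ∈ kunnethPiece W X (show (2 * e - (i : ℕ)) + i = 2 * e by omega))
    (hΓ : ∑ i, ρ i = γ) (i : Fin (2 * e + 1)) :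
    ρ i ∈ algebraicClasses (W ⊗ X) e :=
  kunnethComponent_mem_algebraicClasses_of_le_two' (d := 1) hW hX he (by omega) hγ hρ hΓ i

/-- **Surface classes**: every algebraic class of `2`-cycles, `γ ∈ Nᵉ H^{2e}((W ⊗ X)(ℂ); ℂ)` with
`2 + e = dim W + dim X`, on ANY product of smooth projective complex varieties has algebraic Künneth
components (`C` for surfaces). [cite: Kahn2020, §6.9 Lemma 6.30 and Theorem 6.31 (2)]
[cite: Voisin2025, §3.2.1 Cor. 3.9] -/
theorem kunnethComponent_mem_algebraicClasses_surfaceClasses (hW : IsSmoothProjective m W)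
    (hX : IsSmoothProjective n X) (he : 2 + e = m + n)
    {γ : complexBetti (W ⊗ X) (2 * e)} (hγ : γ ∈ algebraicClasses (W ⊗ X) e)
    {ρ : Fin (2 * e + 1) → complexBetti (W ⊗ X) (2 * e)}
    (hρ : ∀ i : Fin (2 * e + 1), ρ i ∈ kunnethPiece W X (show (2 * e - (i : ℕ)) + i = 2 * e by omega))
    (hΓ : ∑ i, ρ i = γ) (i : Fin (2 * e + 1)) :
    ρ i ∈ algebraicClasses (W ⊗ X) e :=
  kunnethComponent_mem_algebraicClasses_of_le_two' (d := 2) hW hX he le_rfl hγ hρ hΓ i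

/-! ### §4 Explicit families of dominating varieties, any dimensions -/

/-- **A class whose cycles are dominated by varieties satisfying `C` has algebraic Künneth components**,
any dimensions: `γ = Σⱼ aⱼ · (hⱼ)_* 1_{Vⱼ} ∈ H^{2e}((W ⊗ X)(ℂ); ℂ)`, `hⱼ : Vⱼ ⟶ W ⊗ X` from smooth
projective `d`-folds with `C(Vⱼ)`, `d + e = dim W + dim X` (the tree's
`kunnethComponent_mem_algebraicClasses_of_eq_sum_complexGysin_one` without `dim W ≤ d`).
[cite: Kahn2020, §6.9 Def. 6.29 and Lemma 6.30] [cite: Kleiman1968AlgebraicCycles, §2]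
[cite: Fulton1998, §16.1 Prop. 16.1.1 (c)] -/
theorem kunnethComponent_mem_algebraicClasses_of_eq_sum_complexGysin_one' (hW : IsSmoothProjective m W)
    (hX : IsSmoothProjective n X) (hde : d + e = m + n) {ι : Type} [Fintype ι]
    {V : ι → Motives.SchemeOver ℂ} (hV : ∀ j, IsSmoothProjective d (V j)) (h : ∀ j, V j ⟶ W ⊗ X)
    (a : ι → ℂ)
    (hC : ∀ (j : ι) (πV : Fin (2 * d + 1) → complexBetti (V j ⊗ V j) (2 * d)),
      (∀ i : Fin (2 * d + 1), πV i ∈ kunnethPiece (V j) (V j) (show (2 * d - (i : ℕ)) + i = 2 * d by omega)) →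
      ∑ i, πV i = diagonalClass (hV j) → ∀ i, πV i ∈ algebraicClasses (V j ⊗ V j) d)
    {ρ : Fin (2 * e + 1) → complexBetti (W ⊗ X) (2 * e)}
    (hρ : ∀ i : Fin (2 * e + 1), ρ i ∈ kunnethPiece W X (show (2 * e - (i : ℕ)) + i = 2 * e by omega))
    (hΓ : ∑ i, ρ i = ∑ j, a j • complexGysin complexOrientationFamily (hV j)
      (Motives.IsSmoothProjective.tensor_holds hW hX) (h j) (show 0 + 2 * (m + n) = 2 * e + 2 * d by omega)
      (singularCohomology.one ℂ (ComplexPoints (V j))))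
    (i : Fin (2 * e + 1)) :
    ρ i ∈ algebraicClasses (W ⊗ X) e := by
  have hmem : (∑ j, a j • complexGysin complexOrientationFamily (hV j)
      (Motives.IsSmoothProjective.tensor_holds hW hX) (h j) (show 0 + 2 * (m + n) = 2 * e + 2 * d by omega)
      (singularCohomology.one ℂ (ComplexPoints (V j)))) ∈
      Submodule.span ℂ (Set.range fun j ↦ complexGysin complexOrientationFamily (hV j)
        (Motives.IsSmoothProjective.tensor_holds hW hX) (h j) (show 0 + 2 * (m + n) = 2 * e + 2 * d by omega)
        (singularCohomology.one ℂ (ComplexPoints (V j)))) :=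
    Submodule.sum_mem _ fun j _ ↦ Submodule.smul_mem _ _ (Submodule.subset_span (Set.mem_range_self j))
  refine kunnethComponent_mem_algebraicClasses_of_mem_span hW hX ?_ hmem hρ hΓ i
  rintro _ ⟨j, rfl⟩ ρ' hρ' hΓ'
  dsimp only at hΓ'
  have hh : h j = lift (h j ≫ fst W X) (h j ≫ snd W X) := by ext <;> simp
  rw [hh] at hΓ'
  exact kunnethComponent_pushPullClass_mem_algebraicClasses_of_forall' (hV j) hW hX (h j ≫ fst W X)
    (h j ≫ snd W X) hde (hC j) hρ' hΓ'

/-- **Cycles dominated by abelian varieties, any dimensions**: `γ = Σⱼ aⱼ · (hⱼ)_* 1` with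
`hⱼ : Aⱼ ⟶ W ⊗ X` from complex abelian varieties of dimension `d`, `d + e = dim W + dim X`
(`C(A)`: the tree's `AbelianVariety.kunnethComponent_diagonalClass_mem_algebraicClasses`).
[cite: Kahn2020, §6.9 Lemma 6.30 and Theorem 6.31 (3)] [cite: Kleiman1968AlgebraicCycles, §2 Appendix (2A11)] -/
theorem kunnethComponent_mem_algebraicClasses_of_eq_sum_complexGysin_one_abelianVariety'
    (hW : IsSmoothProjective m W) (hX : IsSmoothProjective n X) (hde : d + e = m + n)
    {ι : Type} [Fintype ι] (A : ι → Motives.AbelianVariety ℂ) (hA : ∀ j, (A j).dim = d)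
    (h : ∀ j, (A j).X ⟶ W ⊗ X) (a : ι → ℂ)
    {ρ : Fin (2 * e + 1) → complexBetti (W ⊗ X) (2 * e)}
    (hρ : ∀ i : Fin (2 * e + 1), ρ i ∈ kunnethPiece W X (show (2 * e - (i : ℕ)) + i = 2 * e by omega))
    (hΓ : ∑ i, ρ i = ∑ j, a j • complexGysin complexOrientationFamily
      ((hA j) ▸ Motives.AbelianVariety.isSmoothProjective_holds (A := A j))
      (Motives.IsSmoothProjective.tensor_holds hW hX) (h j) (show 0 + 2 * (m + n) = 2 * e + 2 * d by omega)
      (singularCohomology.one ℂ (ComplexPoints (A j).X)))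
    (i : Fin (2 * e + 1)) :
    ρ i ∈ algebraicClasses (W ⊗ X) e := by
  refine kunnethComponent_mem_algebraicClasses_of_eq_sum_complexGysin_one' hW hX hde
    (fun j ↦ (hA j) ▸ Motives.AbelianVariety.isSmoothProjective_holds (A := A j)) h a
    (fun j πV hπV hΔV k ↦ ?_) hρ hΓ i
  exact kunnethComponents_algebraic_of_dim_eq (hA j) Motives.AbelianVariety.isSmoothProjective_holds _
    (fun _ hπA hΔA k' ↦ (A j).kunnethComponent_diagonalClass_mem_algebraicClasses hπA hΔA k') hπV hΔV k

/-- **Cycles dominated by products of varieties of dimension `≤ 2`, any dimensions**: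
`γ = Σⱼ aⱼ · (hⱼ)_* 1` with `hⱼ : Pⱼ ⊗ Qⱼ ⟶ W ⊗ X`, `dim Pⱼ = p ≤ 2`, `dim Qⱼ = q ≤ 2`,
`p + q + e = dim W + dim X` (`C(P × Q)`: the tree's
`kunnethComponent_diagonalClass_mem_algebraicClasses_tensor_of_le_two`).
[cite: Kahn2020, §6.9 Lemma 6.30 (2)–(3) and Theorem 6.31 (1)–(2)] [cite: Kleiman1968AlgebraicCycles, §2] -/
theorem kunnethComponent_mem_algebraicClasses_of_eq_sum_complexGysin_one_tensor_of_le_two' {p q : ℕ}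
    (hW : IsSmoothProjective m W) (hX : IsSmoothProjective n X) (hde : (p + q) + e = m + n)
    (hp : p ≤ 2) (hq : q ≤ 2) {ι : Type} [Fintype ι] {P Q : ι → Motives.SchemeOver ℂ}
    (hP : ∀ j, IsSmoothProjective p (P j)) (hQ : ∀ j, IsSmoothProjective q (Q j))
    (h : ∀ j, P j ⊗ Q j ⟶ W ⊗ X) (a : ι → ℂ)
    {ρ : Fin (2 * e + 1) → complexBetti (W ⊗ X) (2 * e)}
    (hρ : ∀ i : Fin (2 * e + 1), ρ i ∈ kunnethPiece W X (show (2 * e - (i : ℕ)) + i = 2 * e by omega))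
    (hΓ : ∑ i, ρ i = ∑ j, a j • complexGysin complexOrientationFamily
      (Motives.IsSmoothProjective.tensor_holds (hP j) (hQ j))
      (Motives.IsSmoothProjective.tensor_holds hW hX) (h j)
      (show 0 + 2 * (m + n) = 2 * e + 2 * (p + q) by omega)
      (singularCohomology.one ℂ (ComplexPoints (P j ⊗ Q j))))
    (i : Fin (2 * e + 1)) :
    ρ i ∈ algebraicClasses (W ⊗ X) e :=
  kunnethComponent_mem_algebraicClasses_of_eq_sum_complexGysin_one' hW hX hde
    (fun j ↦ Motives.IsSmoothProjective.tensor_holds (hP j) (hQ j)) h a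
    (fun j _ hπV hΔV k ↦
      kunnethComponent_diagonalClass_mem_algebraicClasses_tensor_of_le_two (hP j) (hQ j) hp hq hπV hΔV k)
    hρ hΓ i

/-- **Cycles dominated along surjections by varieties satisfying `C`**: `γ = Σⱼ aⱼ · (hⱼ)_* 1_{Vⱼ}` with
`hⱼ : Vⱼ ⟶ W ⊗ X` from smooth projective `d`-folds (`d + e = dim W + dim X`) each admitting a surjection
`gⱼ : Yⱼ ⟶ Vⱼ` from a smooth projective `Yⱼ` of dimension `k j` with `C(Yⱼ)` (any relative dimension) —
then every Künneth component of `γ` is algebraic (`C(Yⱼ) ⟹ C(Vⱼ)`, the tree's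
`kunnethComponents_algebraic_of_surjective`). [cite: Kahn2020, §6.9 Lemma 6.30 (2)]
[cite: Voisin2002, §7.3.2 Lemma 7.28] -/
theorem kunnethComponent_mem_algebraicClasses_of_eq_sum_complexGysin_one_of_surjective
    (hW : IsSmoothProjective m W) (hX : IsSmoothProjective n X) (hde : d + e = m + n) {ι : Type} [Fintype ι]
    {V : ι → Motives.SchemeOver ℂ} (hV : ∀ j, IsSmoothProjective d (V j)) (h : ∀ j, V j ⟶ W ⊗ X)
    (a : ι → ℂ) {k : ι → ℕ} {Y : ι → Motives.SchemeOver ℂ} (hY : ∀ j, IsSmoothProjective (k j) (Y j))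
    (g : ∀ j, Y j ⟶ V j) [∀ j, Surjective (g j).left]
    (hCY : ∀ (j : ι) (πY : Fin (2 * k j + 1) → complexBetti (Y j ⊗ Y j) (2 * k j)),
      (∀ i : Fin (2 * k j + 1), πY i ∈ kunnethPiece (Y j) (Y j)
        (show (2 * k j - (i : ℕ)) + i = 2 * k j by omega)) →
      ∑ i, πY i = diagonalClass (hY j) → ∀ i, πY i ∈ algebraicClasses (Y j ⊗ Y j) (k j))
    {ρ : Fin (2 * e + 1) → complexBetti (W ⊗ X) (2 * e)}
    (hρ : ∀ i : Fin (2 * e + 1), ρ i ∈ kunnethPiece W X (show (2 * e - (i : ℕ)) + i = 2 * e by omega))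
    (hΓ : ∑ i, ρ i = ∑ j, a j • complexGysin complexOrientationFamily (hV j)
      (Motives.IsSmoothProjective.tensor_holds hW hX) (h j) (show 0 + 2 * (m + n) = 2 * e + 2 * d by omega)
      (singularCohomology.one ℂ (ComplexPoints (V j))))
    (i : Fin (2 * e + 1)) :
    ρ i ∈ algebraicClasses (W ⊗ X) e :=
  kunnethComponent_mem_algebraicClasses_of_eq_sum_complexGysin_one' hW hX hde hV h a
    (fun j _ hπV hΔV i' ↦ kunnethComponents_algebraic_of_surjective (hY j) (hV j) (g j) (hCY j) hπV hΔV i')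
    hρ hΓ i

/-- **Cycles dominated by abelian varieties of ANY dimension**: `γ = Σⱼ aⱼ · (hⱼ)_* 1_{Vⱼ}` with each
smooth projective `d`-fold `Vⱼ` the image of a surjection `Aⱼ ⟶ Vⱼ` from a complex abelian variety (e.g.
cycles swept out by abelian families), `d + e = dim W + dim X`: all Künneth components of `γ` are
algebraic (`C(A)`, Lieberman–Kleiman, descends to `Vⱼ`).
[cite: Kahn2020, §6.9 Lemma 6.30 (2) and Theorem 6.31 (3)] [cite: Kleiman1968AlgebraicCycles, §2 Appendix (2A11)] -/
theorem kunnethComponent_mem_algebraicClasses_of_eq_sum_complexGysin_one_of_surjective_abelianVariety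
    (hW : IsSmoothProjective m W) (hX : IsSmoothProjective n X) (hde : d + e = m + n) {ι : Type} [Fintype ι]
    {V : ι → Motives.SchemeOver ℂ} (hV : ∀ j, IsSmoothProjective d (V j)) (h : ∀ j, V j ⟶ W ⊗ X)
    (a : ι → ℂ) (A : ι → Motives.AbelianVariety ℂ) (g : ∀ j, (A j).X ⟶ V j) [∀ j, Surjective (g j).left]
    {ρ : Fin (2 * e + 1) → complexBetti (W ⊗ X) (2 * e)}
    (hρ : ∀ i : Fin (2 * e + 1), ρ i ∈ kunnethPiece W X (show (2 * e - (i : ℕ)) + i = 2 * e by omega))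
    (hΓ : ∑ i, ρ i = ∑ j, a j • complexGysin complexOrientationFamily (hV j)
      (Motives.IsSmoothProjective.tensor_holds hW hX) (h j) (show 0 + 2 * (m + n) = 2 * e + 2 * d by omega)
      (singularCohomology.one ℂ (ComplexPoints (V j))))
    (i : Fin (2 * e + 1)) :
    ρ i ∈ algebraicClasses (W ⊗ X) e :=
  kunnethComponent_mem_algebraicClasses_of_eq_sum_complexGysin_one' hW hX hde hV h a
    (fun j _ hπV hΔV i' ↦ kunnethComponents_algebraic_of_surjective_abelianVariety (A j) (hV j) (g j) hπV hΔV i')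
    hρ hΓ i

/-- **Cycles dominated by products `P × Q` of varieties of dimension `≤ 2`, of any dimension `≥` the
cycle dimension**: `γ = Σⱼ aⱼ · (hⱼ)_* 1_{Vⱼ}` with each `Vⱼ` (smooth projective of dimension `d`,
`d + e = dim W + dim X`) the image of a surjection `Pⱼ ⊗ Qⱼ ⟶ Vⱼ`, `dim Pⱼ = p ≤ 2`, `dim Qⱼ = q ≤ 2`
(e.g. cycles dominated by products of curves and surfaces in any relative dimension): all Künneth
components of `γ` are algebraic. [cite: Kahn2020, §6.9 Lemma 6.30 (2)–(3) and Theorem 6.31 (1)–(2)]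
[cite: Voisin2002, §7.3.2 Lemma 7.28] -/
theorem kunnethComponent_mem_algebraicClasses_of_eq_sum_complexGysin_one_of_surjective_tensor_of_le_two
    {p q : ℕ} (hW : IsSmoothProjective m W) (hX : IsSmoothProjective n X) (hde : d + e = m + n)
    (hp : p ≤ 2) (hq : q ≤ 2) {ι : Type} [Fintype ι]
    {V : ι → Motives.SchemeOver ℂ} (hV : ∀ j, IsSmoothProjective d (V j)) (h : ∀ j, V j ⟶ W ⊗ X)
    (a : ι → ℂ) {P Q : ι → Motives.SchemeOver ℂ}
    (hP : ∀ j, IsSmoothProjective p (P j)) (hQ : ∀ j, IsSmoothProjective q (Q j))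
    (g : ∀ j, P j ⊗ Q j ⟶ V j) [∀ j, Surjective (g j).left]
    {ρ : Fin (2 * e + 1) → complexBetti (W ⊗ X) (2 * e)}
    (hρ : ∀ i : Fin (2 * e + 1), ρ i ∈ kunnethPiece W X (show (2 * e - (i : ℕ)) + i = 2 * e by omega))
    (hΓ : ∑ i, ρ i = ∑ j, a j • complexGysin complexOrientationFamily (hV j)
      (Motives.IsSmoothProjective.tensor_holds hW hX) (h j) (show 0 + 2 * (m + n) = 2 * e + 2 * d by omega)
      (singularCohomology.one ℂ (ComplexPoints (V j))))
    (i : Fin (2 * e + 1)) :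
    ρ i ∈ algebraicClasses (W ⊗ X) e :=
  kunnethComponent_mem_algebraicClasses_of_eq_sum_complexGysin_one' hW hX hde hV h a
    (fun j _ hπV hΔV i' ↦
      kunnethComponents_algebraic_of_surjective_tensor_of_le_two (hP j) (hQ j) hp hq (hV j) (g j) hπV hΔV i')
    hρ hΓ i

end Literature.AlgebraicGeometry.HodgeTheory

end
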